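import Literature.Computability.Complexity.StackFFTPasses
import HarnessLib

/-!
# The register file of the recursion driver of the fast negacyclic multiplier

Literature / complexity toolkit, continuing `StackFFTPasses.lean`.  The driver of the breadth-first
negacyclic multiplier (`StackFFTDriverSteps.lean`, `StackFFTDriver.lean`) works over the register
roles `GReg` = the level-pass roles `f x` plus the batches `BF BG`, the results `RR`, twiddle
copies, the history `HIST`, the schedule `SCHED`, the exponent `KN` and its numerals.  As in
`StackFFTLevel.lean` (`FSlots` / `fSt`), the registers the driver rewrites are collected in a
record `GSlots`; `gBase q T w` is the ambient file with the driver's variables set and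
`gSt q T w = fSt (rFG q) (gBase q T w) w.fz` the full file.  The file is the (mechanical) simp
interface: read / write lemmas for every field (`gBase_X`, `update_gBase_X`, `fSt_gX`,
`fSt_update_gX`, `gSt_X`, `update_gSt_X`, the slots `gSt_sX`), pass-through reads
`gBase_v / gBase_n / gBase_f / gSt_v / gSt_n`, and `gSt_eq_fSt`, `fSt_gBase`.

## References

* T. Nipkow, G. Klein, *Concrete Semantics with Isabelle/HOL*, Springer 2014, §7.2 (register
  files as functions; the frame reasoning style of `StackZnVectors.lean`). (Folklore material,
  fully proved here.)
-/

namespace Literature.Computability.Complexity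

open _root_.Computability SProg

namespace Com

/-- Register roles of the recursion driver: the level-pass roles `f x`, the batches `BF`, `BG`,
the results `RR`, twiddle copies `TW2 TWS TW3`, the history `HIST` of twiddle lists (with its
transit `TMPH`), the schedule `SCHED`, the exponent `KN` and its test `KD = k ∸ 3`, constants
`THREE`, `ONE`, `CINV = (N+1)/2`, per-depth numerals `AR` (`a`), `LVN` (`lv`), `MREG` (`m`),
`TREG` (`t`), the unary level counter `LVU`, and the loop token `W0`. [folklore] -/
inductive GReg
  | f (x : FReg) | BF | BG | RR | TW2 | TWS | TW3 | TMPH | HIST | SCHED | KN | KD | THREE | ONE | CINV | AR | LVN | LVU | MREG | TREG | W0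
  deriving DecidableEq

/-- The level-pass roles inside the driver roles. [folklore] -/
def GReg.ιF : FReg ↪ GReg := ⟨GReg.f, fun _ _ h => GReg.f.inj h⟩

/-- `ιF` is the constructor `f`. [folklore] -/
@[simp] theorem GReg.ιF_apply (x : FReg) : GReg.ιF x = .f x := rfl

variable {β : Type} [DecidableEq β] (q : GReg ↪ β)

/-- The level-pass roles in the ambient index type. [folklore] -/
abbrev rFG : FReg ↪ β := GReg.ιF.trans q

/-- The vector-pass roles in the ambient index type (through the driver). [folklore] -/
abbrev rVG : VReg ↪ β := rVF (rFG q)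

omit [DecidableEq β] in
/-- Reading a level-pass role. [folklore] -/
@[simp] theorem rFG_apply (x : FReg) : rFG q x = q (.f x) := rfl

omit [DecidableEq β] in
/-- Reading a vector-pass role. [folklore] -/
@[simp] theorem rVG_apply (x : VReg) : rVG q x = q (.f (.n (.v x))) := rfl

/-- The driver's variables: the registers the driver rewrites, and the record of the level-pass
working registers. [folklore] -/
structure GSlots where
  /-- register `BF` -/ (bf : List Bool)
  /-- register `BG` -/ (bg : List Bool)
  /-- register `RR` -/ (rr : List Bool)
  /-- register `TW2` -/ (tw2 : List Bool)
  /-- register `TWS` -/ (tws : List Bool)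
  /-- register `TW3` -/ (tw3 : List Bool)
  /-- register `TMPH` -/ (tmph : List Bool)
  /-- register `HIST` -/ (hist : List Bool)
  /-- register `SCHED` -/ (sched : List Bool)
  /-- register `KN` -/ (kn : List Bool)
  /-- register `KD` -/ (kd : List Bool)
  /-- register `AR` -/ (ar : List Bool)
  /-- register `LVN` -/ (lvn : List Bool)
  /-- register `LVU` -/ (lvu : List Bool)
  /-- register `MREG` -/ (mreg : List Bool)
  /-- register `TREG` -/ (treg : List Bool)
  /-- register `W0` -/ (w0 : List Bool)
  /-- register `HN` (level-pass constant / output, a driver variable) -/ (hn : List Bool)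
  /-- register `M2` (level-pass constant / output, a driver variable) -/ (m2 : List Bool)
  /-- register `M4` (level-pass constant / output, a driver variable) -/ (m4 : List Bool)
  /-- register `OUT` (level-pass constant / output, a driver variable) -/ (out : List Bool)
  /-- register `TWOUT` (level-pass constant / output, a driver variable) -/ (twout : List Bool)
  /-- register `LEN` (vector-pass constant, a driver variable) -/ (len : List Bool)
  /-- register `C` (vector-pass constant, a driver variable) -/ (cc : List Bool)
  /-- the level-pass working registers -/ (fz : FSlots)

/-- The base file seen by the level passes: the ambient file with the driver's variables set. [folklore] -/
def gBase (T : Regs β) (w : GSlots) : Regs β :=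
  Function.update (Function.update (Function.update (Function.update (Function.update (Function.update (Function.update (Function.update (Function.update (Function.update (Function.update (Function.update (Function.update (Function.update (Function.update (Function.update (Function.update (Function.update (Function.update (Function.update (Function.update (Function.update (Function.update (Function.update (T) (q .BF) w.bf) (q .BG) w.bg) (q .RR) w.rr) (q .TW2) w.tw2) (q .TWS) w.tws) (q .TW3) w.tw3) (q .TMPH) w.tmph) (q .HIST) w.hist) (q .SCHED) w.sched) (q .KN) w.kn) (q .KD) w.kd) (q .AR) w.ar) (q .LVN) w.lvn) (q .LVU) w.lvu) (q .MREG) w.mreg) (q .TREG) w.treg) (q .W0) w.w0) (q (.f .HN)) w.hn) (q (.f .M2)) w.m2) (q (.f .M4)) w.m4) (q (.f .OUT)) w.out) (q (.f .TWOUT)) w.twout) (q (.f (.n (.v .LEN)))) w.len) (q (.f (.n (.v .C)))) w.cc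

/-- The full register file of a driver state. [folklore] -/
def gSt (T : Regs β) (w : GSlots) : Regs β := fSt (rFG q) (gBase q T w) w.fz

section GStLemmas

variable (T : Regs β) (w : GSlots) (u : List Bool)

omit [DecidableEq β] in
/-- Distinct roles are distinct registers. [folklore] -/
theorem gq_ne {i j : GReg} (h : i ≠ j) : q i ≠ q j := fun e => h (q.injective e)

/-- Reading `BF` of the base. [folklore] -/
@[simp] theorem gBase_BF : gBase q T w (q .BF) = w.bf := by
  simp [gBase, gq_ne q]
/-- Reading `BG` of the base. [folklore] -/
@[simp] theorem gBase_BG : gBase q T w (q .BG) = w.bg := by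
  simp [gBase, gq_ne q]
/-- Reading `RR` of the base. [folklore] -/
@[simp] theorem gBase_RR : gBase q T w (q .RR) = w.rr := by
  simp [gBase, gq_ne q]
/-- Reading `TW2` of the base. [folklore] -/
@[simp] theorem gBase_TW2 : gBase q T w (q .TW2) = w.tw2 := by
  simp [gBase, gq_ne q]
/-- Reading `TWS` of the base. [folklore] -/
@[simp] theorem gBase_TWS : gBase q T w (q .TWS) = w.tws := by
  simp [gBase, gq_ne q]
/-- Reading `TW3` of the base. [folklore] -/
@[simp] theorem gBase_TW3 : gBase q T w (q .TW3) = w.tw3 := by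
  simp [gBase, gq_ne q]
/-- Reading `TMPH` of the base. [folklore] -/
@[simp] theorem gBase_TMPH : gBase q T w (q .TMPH) = w.tmph := by
  simp [gBase, gq_ne q]
/-- Reading `HIST` of the base. [folklore] -/
@[simp] theorem gBase_HIST : gBase q T w (q .HIST) = w.hist := by
  simp [gBase, gq_ne q]
/-- Reading `SCHED` of the base. [folklore] -/
@[simp] theorem gBase_SCHED : gBase q T w (q .SCHED) = w.sched := by
  simp [gBase, gq_ne q]
/-- Reading `KN` of the base. [folklore] -/
@[simp] theorem gBase_KN : gBase q T w (q .KN) = w.kn := by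
  simp [gBase, gq_ne q]
/-- Reading `KD` of the base. [folklore] -/
@[simp] theorem gBase_KD : gBase q T w (q .KD) = w.kd := by
  simp [gBase, gq_ne q]
/-- Reading `AR` of the base. [folklore] -/
@[simp] theorem gBase_AR : gBase q T w (q .AR) = w.ar := by
  simp [gBase, gq_ne q]
/-- Reading `LVN` of the base. [folklore] -/
@[simp] theorem gBase_LVN : gBase q T w (q .LVN) = w.lvn := by
  simp [gBase, gq_ne q]
/-- Reading `LVU` of the base. [folklore] -/
@[simp] theorem gBase_LVU : gBase q T w (q .LVU) = w.lvu := by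
  simp [gBase, gq_ne q]
/-- Reading `MREG` of the base. [folklore] -/
@[simp] theorem gBase_MREG : gBase q T w (q .MREG) = w.mreg := by
  simp [gBase, gq_ne q]
/-- Reading `TREG` of the base. [folklore] -/
@[simp] theorem gBase_TREG : gBase q T w (q .TREG) = w.treg := by
  simp [gBase, gq_ne q]
/-- Reading `W0` of the base. [folklore] -/
@[simp] theorem gBase_W0 : gBase q T w (q .W0) = w.w0 := by
  simp [gBase, gq_ne q]
/-- Reading `HN` of the base. [folklore] -/
@[simp] theorem gBase_HN : gBase q T w (q (.f .HN)) = w.hn := by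
  simp [gBase, gq_ne q]
/-- Reading `M2` of the base. [folklore] -/
@[simp] theorem gBase_M2 : gBase q T w (q (.f .M2)) = w.m2 := by
  simp [gBase, gq_ne q]
/-- Reading `M4` of the base. [folklore] -/
@[simp] theorem gBase_M4 : gBase q T w (q (.f .M4)) = w.m4 := by
  simp [gBase, gq_ne q]
/-- Reading `OUT` of the base. [folklore] -/
@[simp] theorem gBase_OUT : gBase q T w (q (.f .OUT)) = w.out := by
  simp [gBase, gq_ne q]
/-- Reading `TWOUT` of the base. [folklore] -/
@[simp] theorem gBase_TWOUT : gBase q T w (q (.f .TWOUT)) = w.twout := by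
  simp [gBase, gq_ne q]
/-- Reading `LEN` of the base. [folklore] -/
@[simp] theorem gBase_LEN : gBase q T w (q (.f (.n (.v .LEN)))) = w.len := by
  simp [gBase, gq_ne q]
/-- Reading `C` of the base. [folklore] -/
@[simp] theorem gBase_C : gBase q T w (q (.f (.n (.v .C)))) = w.cc := by
  simp [gBase]
/-- Reading an untouched vector-pass register of the base. [folklore] -/
theorem gBase_v {x : VReg} (h1 : x ≠ .LEN) (h2 : x ≠ .C) : gBase q T w (q (.f (.n (.v x)))) = T (q (.f (.n (.v x)))) := by
  simp [gBase, gq_ne q, h1, h2]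
/-- Reading an untouched multiplier register of the base. [folklore] -/
theorem gBase_n {x : NReg} (h1 : x ≠ .v .LEN) (h2 : x ≠ .v .C) : gBase q T w (q (.f (.n x))) = T (q (.f (.n x))) := by
  simp [gBase, gq_ne q, h1, h2]
/-- Reading the level-pass slot keys of the base (irrelevant: overwritten by `fSt`). [folklore] -/
theorem gBase_f {x : FReg} (h1 : x ≠ .HN) (h2 : x ≠ .M2) (h3 : x ≠ .M4) (h4 : x ≠ .OUT) (h5 : x ≠ .TWOUT)
    (h6 : x ≠ .n (.v .LEN)) (h7 : x ≠ .n (.v .C)) : gBase q T w (q (.f x)) = T (q (.f x)) := by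
  simp [gBase, gq_ne q, h1, h2, h3, h4, h5, h6, h7]
/-- Reading the constant `CINV`. [folklore] -/
@[simp] theorem gBase_CINV : gBase q T w (q .CINV) = T (q .CINV) := by
  simp [gBase, gq_ne q]
/-- Reading the constant `THREE`. [folklore] -/
@[simp] theorem gBase_THREE : gBase q T w (q .THREE) = T (q .THREE) := by
  simp [gBase, gq_ne q]
/-- Reading the constant `ONE`. [folklore] -/
@[simp] theorem gBase_ONE : gBase q T w (q .ONE) = T (q .ONE) := by
  simp [gBase, gq_ne q]
/-- Writing `BF` of the base. [folklore] -/
@[simp] theorem update_gBase_BF : Function.update (gBase q T w) (q .BF) u = gBase q T { w with bf := u } := by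
  funext y
  simp only [gBase, Function.update_apply]
  by_cases hy : y = (q .BF) <;> simp [hy, gq_ne q]
/-- Writing `BG` of the base. [folklore] -/
@[simp] theorem update_gBase_BG : Function.update (gBase q T w) (q .BG) u = gBase q T { w with bg := u } := by
  funext y
  simp only [gBase, Function.update_apply]
  by_cases hy : y = (q .BG) <;> simp [hy, gq_ne q]
/-- Writing `RR` of the base. [folklore] -/
@[simp] theorem update_gBase_RR : Function.update (gBase q T w) (q .RR) u = gBase q T { w with rr := u } := by
  funext y
  simp only [gBase, Function.update_apply]
  by_cases hy : y = (q .RR) <;> simp [hy, gq_ne q]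
/-- Writing `TW2` of the base. [folklore] -/
@[simp] theorem update_gBase_TW2 : Function.update (gBase q T w) (q .TW2) u = gBase q T { w with tw2 := u } := by
  funext y
  simp only [gBase, Function.update_apply]
  by_cases hy : y = (q .TW2) <;> simp [hy, gq_ne q]
/-- Writing `TWS` of the base. [folklore] -/
@[simp] theorem update_gBase_TWS : Function.update (gBase q T w) (q .TWS) u = gBase q T { w with tws := u } := by
  funext y
  simp only [gBase, Function.update_apply]
  by_cases hy : y = (q .TWS) <;> simp [hy, gq_ne q]
/-- Writing `TW3` of the base. [folklore] -/
@[simp] theorem update_gBase_TW3 : Function.update (gBase q T w) (q .TW3) u = gBase q T { w with tw3 := u } := by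
  funext y
  simp only [gBase, Function.update_apply]
  by_cases hy : y = (q .TW3) <;> simp [hy, gq_ne q]
/-- Writing `TMPH` of the base. [folklore] -/
@[simp] theorem update_gBase_TMPH : Function.update (gBase q T w) (q .TMPH) u = gBase q T { w with tmph := u } := by
  funext y
  simp only [gBase, Function.update_apply]
  by_cases hy : y = (q .TMPH) <;> simp [hy, gq_ne q]
/-- Writing `HIST` of the base. [folklore] -/
@[simp] theorem update_gBase_HIST : Function.update (gBase q T w) (q .HIST) u = gBase q T { w with hist := u } := by
  funext y
  simp only [gBase, Function.update_apply]
  by_cases hy : y = (q .HIST) <;> simp [hy, gq_ne q]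
/-- Writing `SCHED` of the base. [folklore] -/
@[simp] theorem update_gBase_SCHED : Function.update (gBase q T w) (q .SCHED) u = gBase q T { w with sched := u } := by
  funext y
  simp only [gBase, Function.update_apply]
  by_cases hy : y = (q .SCHED) <;> simp [hy, gq_ne q]
/-- Writing `KN` of the base. [folklore] -/
@[simp] theorem update_gBase_KN : Function.update (gBase q T w) (q .KN) u = gBase q T { w with kn := u } := by
  funext y
  simp only [gBase, Function.update_apply]
  by_cases hy : y = (q .KN) <;> simp [hy, gq_ne q]
/-- Writing `KD` of the base. [folklore] -/
@[simp] theorem update_gBase_KD : Function.update (gBase q T w) (q .KD) u = gBase q T { w with kd := u } := by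
  funext y
  simp only [gBase, Function.update_apply]
  by_cases hy : y = (q .KD) <;> simp [hy, gq_ne q]
/-- Writing `AR` of the base. [folklore] -/
@[simp] theorem update_gBase_AR : Function.update (gBase q T w) (q .AR) u = gBase q T { w with ar := u } := by
  funext y
  simp only [gBase, Function.update_apply]
  by_cases hy : y = (q .AR) <;> simp [hy, gq_ne q]
/-- Writing `LVN` of the base. [folklore] -/
@[simp] theorem update_gBase_LVN : Function.update (gBase q T w) (q .LVN) u = gBase q T { w with lvn := u } := by
  funext y
  simp only [gBase, Function.update_apply]
  by_cases hy : y = (q .LVN) <;> simp [hy, gq_ne q]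
/-- Writing `LVU` of the base. [folklore] -/
@[simp] theorem update_gBase_LVU : Function.update (gBase q T w) (q .LVU) u = gBase q T { w with lvu := u } := by
  funext y
  simp only [gBase, Function.update_apply]
  by_cases hy : y = (q .LVU) <;> simp [hy, gq_ne q]
/-- Writing `MREG` of the base. [folklore] -/
@[simp] theorem update_gBase_MREG : Function.update (gBase q T w) (q .MREG) u = gBase q T { w with mreg := u } := by
  funext y
  simp only [gBase, Function.update_apply]
  by_cases hy : y = (q .MREG) <;> simp [hy, gq_ne q]
/-- Writing `TREG` of the base. [folklore] -/
@[simp] theorem update_gBase_TREG : Function.update (gBase q T w) (q .TREG) u = gBase q T { w with treg := u } := by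
  funext y
  simp only [gBase, Function.update_apply]
  by_cases hy : y = (q .TREG) <;> simp [hy, gq_ne q]
/-- Writing `W0` of the base. [folklore] -/
@[simp] theorem update_gBase_W0 : Function.update (gBase q T w) (q .W0) u = gBase q T { w with w0 := u } := by
  funext y
  simp only [gBase, Function.update_apply]
  by_cases hy : y = (q .W0) <;> simp [hy, gq_ne q]
/-- Writing `HN` of the base. [folklore] -/
@[simp] theorem update_gBase_HN : Function.update (gBase q T w) (q (.f .HN)) u = gBase q T { w with hn := u } := by
  funext y
  simp only [gBase, Function.update_apply]
  by_cases hy : y = (q (.f .HN)) <;> simp [hy, gq_ne q]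
/-- Writing `M2` of the base. [folklore] -/
@[simp] theorem update_gBase_M2 : Function.update (gBase q T w) (q (.f .M2)) u = gBase q T { w with m2 := u } := by
  funext y
  simp only [gBase, Function.update_apply]
  by_cases hy : y = (q (.f .M2)) <;> simp [hy, gq_ne q]
/-- Writing `M4` of the base. [folklore] -/
@[simp] theorem update_gBase_M4 : Function.update (gBase q T w) (q (.f .M4)) u = gBase q T { w with m4 := u } := by
  funext y
  simp only [gBase, Function.update_apply]
  by_cases hy : y = (q (.f .M4)) <;> simp [hy, gq_ne q]
/-- Writing `OUT` of the base. [folklore] -/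
@[simp] theorem update_gBase_OUT : Function.update (gBase q T w) (q (.f .OUT)) u = gBase q T { w with out := u } := by
  funext y
  simp only [gBase, Function.update_apply]
  by_cases hy : y = (q (.f .OUT)) <;> simp [hy, gq_ne q]
/-- Writing `TWOUT` of the base. [folklore] -/
@[simp] theorem update_gBase_TWOUT : Function.update (gBase q T w) (q (.f .TWOUT)) u = gBase q T { w with twout := u } := by
  funext y
  simp only [gBase, Function.update_apply]
  by_cases hy : y = (q (.f .TWOUT)) <;> simp [hy, gq_ne q]
/-- Writing `LEN` of the base. [folklore] -/
@[simp] theorem update_gBase_LEN : Function.update (gBase q T w) (q (.f (.n (.v .LEN)))) u = gBase q T { w with len := u } := by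
  funext y
  simp only [gBase, Function.update_apply]
  by_cases hy : y = (q (.f (.n (.v .LEN)))) <;> simp [hy, gq_ne q]
/-- Writing `C` of the base. [folklore] -/
@[simp] theorem update_gBase_C : Function.update (gBase q T w) (q (.f (.n (.v .C)))) u = gBase q T { w with cc := u } := by
  funext y
  simp only [gBase, Function.update_apply]
  by_cases hy : y = (q (.f (.n (.v .C)))) <;> simp [hy]

end GStLemmas

section GStLemmas2

variable (T : Regs β) (w : GSlots) (z : FSlots) (u : List Bool)

/-- `BF` is not a level-pass slot: reading. [folklore] -/
theorem fSt_gBF (T' : Regs β) : fSt (rFG q) T' z (q .BF) = T' (q .BF) := by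
  simp [fSt, rFG, Function.Embedding.trans_apply, GReg.ιF_apply, gq_ne q]
/-- `BF` is not a level-pass slot: writing commutes. [folklore] -/
theorem fSt_update_gBF (T' : Regs β) : Function.update (fSt (rFG q) T' z) (q .BF) u = fSt (rFG q) (Function.update T' (q .BF) u) z := by
  funext y
  by_cases hy : y = (q .BF)
  · subst hy; rw [Function.update_self, fSt_gBF, Function.update_self]
  · rw [Function.update_of_ne hy]; simp only [fSt, Function.update_apply, hy, if_false]
/-- `BG` is not a level-pass slot: reading. [folklore] -/
theorem fSt_gBG (T' : Regs β) : fSt (rFG q) T' z (q .BG) = T' (q .BG) := by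
  simp [fSt, rFG, Function.Embedding.trans_apply, GReg.ιF_apply, gq_ne q]
/-- `BG` is not a level-pass slot: writing commutes. [folklore] -/
theorem fSt_update_gBG (T' : Regs β) : Function.update (fSt (rFG q) T' z) (q .BG) u = fSt (rFG q) (Function.update T' (q .BG) u) z := by
  funext y
  by_cases hy : y = (q .BG)
  · subst hy; rw [Function.update_self, fSt_gBG, Function.update_self]
  · rw [Function.update_of_ne hy]; simp only [fSt, Function.update_apply, hy, if_false]
/-- `RR` is not a level-pass slot: reading. [folklore] -/
theorem fSt_gRR (T' : Regs β) : fSt (rFG q) T' z (q .RR) = T' (q .RR) := by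
  simp [fSt, rFG, Function.Embedding.trans_apply, GReg.ιF_apply, gq_ne q]
/-- `RR` is not a level-pass slot: writing commutes. [folklore] -/
theorem fSt_update_gRR (T' : Regs β) : Function.update (fSt (rFG q) T' z) (q .RR) u = fSt (rFG q) (Function.update T' (q .RR) u) z := by
  funext y
  by_cases hy : y = (q .RR)
  · subst hy; rw [Function.update_self, fSt_gRR, Function.update_self]
  · rw [Function.update_of_ne hy]; simp only [fSt, Function.update_apply, hy, if_false]
/-- `TW2` is not a level-pass slot: reading. [folklore] -/
theorem fSt_gTW2 (T' : Regs β) : fSt (rFG q) T' z (q .TW2) = T' (q .TW2) := by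
  simp [fSt, rFG, Function.Embedding.trans_apply, GReg.ιF_apply, gq_ne q]
/-- `TW2` is not a level-pass slot: writing commutes. [folklore] -/
theorem fSt_update_gTW2 (T' : Regs β) : Function.update (fSt (rFG q) T' z) (q .TW2) u = fSt (rFG q) (Function.update T' (q .TW2) u) z := by
  funext y
  by_cases hy : y = (q .TW2)
  · subst hy; rw [Function.update_self, fSt_gTW2, Function.update_self]
  · rw [Function.update_of_ne hy]; simp only [fSt, Function.update_apply, hy, if_false]
/-- `TWS` is not a level-pass slot: reading. [folklore] -/
theorem fSt_gTWS (T' : Regs β) : fSt (rFG q) T' z (q .TWS) = T' (q .TWS) := by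
  simp [fSt, rFG, Function.Embedding.trans_apply, GReg.ιF_apply, gq_ne q]
/-- `TWS` is not a level-pass slot: writing commutes. [folklore] -/
theorem fSt_update_gTWS (T' : Regs β) : Function.update (fSt (rFG q) T' z) (q .TWS) u = fSt (rFG q) (Function.update T' (q .TWS) u) z := by
  funext y
  by_cases hy : y = (q .TWS)
  · subst hy; rw [Function.update_self, fSt_gTWS, Function.update_self]
  · rw [Function.update_of_ne hy]; simp only [fSt, Function.update_apply, hy, if_false]
/-- `TW3` is not a level-pass slot: reading. [folklore] -/
theorem fSt_gTW3 (T' : Regs β) : fSt (rFG q) T' z (q .TW3) = T' (q .TW3) := by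
  simp [fSt, rFG, Function.Embedding.trans_apply, GReg.ιF_apply, gq_ne q]
/-- `TW3` is not a level-pass slot: writing commutes. [folklore] -/
theorem fSt_update_gTW3 (T' : Regs β) : Function.update (fSt (rFG q) T' z) (q .TW3) u = fSt (rFG q) (Function.update T' (q .TW3) u) z := by
  funext y
  by_cases hy : y = (q .TW3)
  · subst hy; rw [Function.update_self, fSt_gTW3, Function.update_self]
  · rw [Function.update_of_ne hy]; simp only [fSt, Function.update_apply, hy, if_false]
/-- `TMPH` is not a level-pass slot: reading. [folklore] -/
theorem fSt_gTMPH (T' : Regs β) : fSt (rFG q) T' z (q .TMPH) = T' (q .TMPH) := by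
  simp [fSt, rFG, Function.Embedding.trans_apply, GReg.ιF_apply, gq_ne q]
/-- `TMPH` is not a level-pass slot: writing commutes. [folklore] -/
theorem fSt_update_gTMPH (T' : Regs β) : Function.update (fSt (rFG q) T' z) (q .TMPH) u = fSt (rFG q) (Function.update T' (q .TMPH) u) z := by
  funext y
  by_cases hy : y = (q .TMPH)
  · subst hy; rw [Function.update_self, fSt_gTMPH, Function.update_self]
  · rw [Function.update_of_ne hy]; simp only [fSt, Function.update_apply, hy, if_false]
/-- `HIST` is not a level-pass slot: reading. [folklore] -/
theorem fSt_gHIST (T' : Regs β) : fSt (rFG q) T' z (q .HIST) = T' (q .HIST) := by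
  simp [fSt, rFG, Function.Embedding.trans_apply, GReg.ιF_apply, gq_ne q]
/-- `HIST` is not a level-pass slot: writing commutes. [folklore] -/
theorem fSt_update_gHIST (T' : Regs β) : Function.update (fSt (rFG q) T' z) (q .HIST) u = fSt (rFG q) (Function.update T' (q .HIST) u) z := by
  funext y
  by_cases hy : y = (q .HIST)
  · subst hy; rw [Function.update_self, fSt_gHIST, Function.update_self]
  · rw [Function.update_of_ne hy]; simp only [fSt, Function.update_apply, hy, if_false]
/-- `SCHED` is not a level-pass slot: reading. [folklore] -/
theorem fSt_gSCHED (T' : Regs β) : fSt (rFG q) T' z (q .SCHED) = T' (q .SCHED) := by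
  simp [fSt, rFG, Function.Embedding.trans_apply, GReg.ιF_apply, gq_ne q]
/-- `SCHED` is not a level-pass slot: writing commutes. [folklore] -/
theorem fSt_update_gSCHED (T' : Regs β) : Function.update (fSt (rFG q) T' z) (q .SCHED) u = fSt (rFG q) (Function.update T' (q .SCHED) u) z := by
  funext y
  by_cases hy : y = (q .SCHED)
  · subst hy; rw [Function.update_self, fSt_gSCHED, Function.update_self]
  · rw [Function.update_of_ne hy]; simp only [fSt, Function.update_apply, hy, if_false]
/-- `KN` is not a level-pass slot: reading. [folklore] -/
theorem fSt_gKN (T' : Regs β) : fSt (rFG q) T' z (q .KN) = T' (q .KN) := by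
  simp [fSt, rFG, Function.Embedding.trans_apply, GReg.ιF_apply, gq_ne q]
/-- `KN` is not a level-pass slot: writing commutes. [folklore] -/
theorem fSt_update_gKN (T' : Regs β) : Function.update (fSt (rFG q) T' z) (q .KN) u = fSt (rFG q) (Function.update T' (q .KN) u) z := by
  funext y
  by_cases hy : y = (q .KN)
  · subst hy; rw [Function.update_self, fSt_gKN, Function.update_self]
  · rw [Function.update_of_ne hy]; simp only [fSt, Function.update_apply, hy, if_false]
/-- `KD` is not a level-pass slot: reading. [folklore] -/
theorem fSt_gKD (T' : Regs β) : fSt (rFG q) T' z (q .KD) = T' (q .KD) := by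
  simp [fSt, rFG, Function.Embedding.trans_apply, GReg.ιF_apply, gq_ne q]
/-- `KD` is not a level-pass slot: writing commutes. [folklore] -/
theorem fSt_update_gKD (T' : Regs β) : Function.update (fSt (rFG q) T' z) (q .KD) u = fSt (rFG q) (Function.update T' (q .KD) u) z := by
  funext y
  by_cases hy : y = (q .KD)
  · subst hy; rw [Function.update_self, fSt_gKD, Function.update_self]
  · rw [Function.update_of_ne hy]; simp only [fSt, Function.update_apply, hy, if_false]
/-- `AR` is not a level-pass slot: reading. [folklore] -/
theorem fSt_gAR (T' : Regs β) : fSt (rFG q) T' z (q .AR) = T' (q .AR) := by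
  simp [fSt, rFG, Function.Embedding.trans_apply, GReg.ιF_apply, gq_ne q]
/-- `AR` is not a level-pass slot: writing commutes. [folklore] -/
theorem fSt_update_gAR (T' : Regs β) : Function.update (fSt (rFG q) T' z) (q .AR) u = fSt (rFG q) (Function.update T' (q .AR) u) z := by
  funext y
  by_cases hy : y = (q .AR)
  · subst hy; rw [Function.update_self, fSt_gAR, Function.update_self]
  · rw [Function.update_of_ne hy]; simp only [fSt, Function.update_apply, hy, if_false]
/-- `LVN` is not a level-pass slot: reading. [folklore] -/
theorem fSt_gLVN (T' : Regs β) : fSt (rFG q) T' z (q .LVN) = T' (q .LVN) := by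
  simp [fSt, rFG, Function.Embedding.trans_apply, GReg.ιF_apply, gq_ne q]
/-- `LVN` is not a level-pass slot: writing commutes. [folklore] -/
theorem fSt_update_gLVN (T' : Regs β) : Function.update (fSt (rFG q) T' z) (q .LVN) u = fSt (rFG q) (Function.update T' (q .LVN) u) z := by
  funext y
  by_cases hy : y = (q .LVN)
  · subst hy; rw [Function.update_self, fSt_gLVN, Function.update_self]
  · rw [Function.update_of_ne hy]; simp only [fSt, Function.update_apply, hy, if_false]
/-- `LVU` is not a level-pass slot: reading. [folklore] -/
theorem fSt_gLVU (T' : Regs β) : fSt (rFG q) T' z (q .LVU) = T' (q .LVU) := by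
  simp [fSt, rFG, Function.Embedding.trans_apply, GReg.ιF_apply, gq_ne q]
/-- `LVU` is not a level-pass slot: writing commutes. [folklore] -/
theorem fSt_update_gLVU (T' : Regs β) : Function.update (fSt (rFG q) T' z) (q .LVU) u = fSt (rFG q) (Function.update T' (q .LVU) u) z := by
  funext y
  by_cases hy : y = (q .LVU)
  · subst hy; rw [Function.update_self, fSt_gLVU, Function.update_self]
  · rw [Function.update_of_ne hy]; simp only [fSt, Function.update_apply, hy, if_false]
/-- `MREG` is not a level-pass slot: reading. [folklore] -/
theorem fSt_gMREG (T' : Regs β) : fSt (rFG q) T' z (q .MREG) = T' (q .MREG) := by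
  simp [fSt, rFG, Function.Embedding.trans_apply, GReg.ιF_apply, gq_ne q]
/-- `MREG` is not a level-pass slot: writing commutes. [folklore] -/
theorem fSt_update_gMREG (T' : Regs β) : Function.update (fSt (rFG q) T' z) (q .MREG) u = fSt (rFG q) (Function.update T' (q .MREG) u) z := by
  funext y
  by_cases hy : y = (q .MREG)
  · subst hy; rw [Function.update_self, fSt_gMREG, Function.update_self]
  · rw [Function.update_of_ne hy]; simp only [fSt, Function.update_apply, hy, if_false]
/-- `TREG` is not a level-pass slot: reading. [folklore] -/
theorem fSt_gTREG (T' : Regs β) : fSt (rFG q) T' z (q .TREG) = T' (q .TREG) := by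
  simp [fSt, rFG, Function.Embedding.trans_apply, GReg.ιF_apply, gq_ne q]
/-- `TREG` is not a level-pass slot: writing commutes. [folklore] -/
theorem fSt_update_gTREG (T' : Regs β) : Function.update (fSt (rFG q) T' z) (q .TREG) u = fSt (rFG q) (Function.update T' (q .TREG) u) z := by
  funext y
  by_cases hy : y = (q .TREG)
  · subst hy; rw [Function.update_self, fSt_gTREG, Function.update_self]
  · rw [Function.update_of_ne hy]; simp only [fSt, Function.update_apply, hy, if_false]
/-- `W0` is not a level-pass slot: reading. [folklore] -/
theorem fSt_gW0 (T' : Regs β) : fSt (rFG q) T' z (q .W0) = T' (q .W0) := by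
  simp [fSt, rFG, Function.Embedding.trans_apply, GReg.ιF_apply, gq_ne q]
/-- `W0` is not a level-pass slot: writing commutes. [folklore] -/
theorem fSt_update_gW0 (T' : Regs β) : Function.update (fSt (rFG q) T' z) (q .W0) u = fSt (rFG q) (Function.update T' (q .W0) u) z := by
  funext y
  by_cases hy : y = (q .W0)
  · subst hy; rw [Function.update_self, fSt_gW0, Function.update_self]
  · rw [Function.update_of_ne hy]; simp only [fSt, Function.update_apply, hy, if_false]
/-- `CINV` is not a level-pass slot: reading. [folklore] -/
theorem fSt_gCINV (T' : Regs β) : fSt (rFG q) T' z (q .CINV) = T' (q .CINV) := by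
  simp [fSt, rFG, Function.Embedding.trans_apply, GReg.ιF_apply, gq_ne q]
/-- `CINV` is not a level-pass slot: writing commutes. [folklore] -/
theorem fSt_update_gCINV (T' : Regs β) : Function.update (fSt (rFG q) T' z) (q .CINV) u = fSt (rFG q) (Function.update T' (q .CINV) u) z := by
  funext y
  by_cases hy : y = (q .CINV)
  · subst hy; rw [Function.update_self, fSt_gCINV, Function.update_self]
  · rw [Function.update_of_ne hy]; simp only [fSt, Function.update_apply, hy, if_false]
/-- `THREE` is not a level-pass slot: reading. [folklore] -/
theorem fSt_gTHREE (T' : Regs β) : fSt (rFG q) T' z (q .THREE) = T' (q .THREE) := by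
  simp [fSt, rFG, Function.Embedding.trans_apply, GReg.ιF_apply, gq_ne q]
/-- `THREE` is not a level-pass slot: writing commutes. [folklore] -/
theorem fSt_update_gTHREE (T' : Regs β) : Function.update (fSt (rFG q) T' z) (q .THREE) u = fSt (rFG q) (Function.update T' (q .THREE) u) z := by
  funext y
  by_cases hy : y = (q .THREE)
  · subst hy; rw [Function.update_self, fSt_gTHREE, Function.update_self]
  · rw [Function.update_of_ne hy]; simp only [fSt, Function.update_apply, hy, if_false]
/-- `ONE` is not a level-pass slot: reading. [folklore] -/
theorem fSt_gONE (T' : Regs β) : fSt (rFG q) T' z (q .ONE) = T' (q .ONE) := by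
  simp [fSt, rFG, Function.Embedding.trans_apply, GReg.ιF_apply, gq_ne q]
/-- `ONE` is not a level-pass slot: writing commutes. [folklore] -/
theorem fSt_update_gONE (T' : Regs β) : Function.update (fSt (rFG q) T' z) (q .ONE) u = fSt (rFG q) (Function.update T' (q .ONE) u) z := by
  funext y
  by_cases hy : y = (q .ONE)
  · subst hy; rw [Function.update_self, fSt_gONE, Function.update_self]
  · rw [Function.update_of_ne hy]; simp only [fSt, Function.update_apply, hy, if_false]
/-- `HN` through `fSt`, driver keys. [folklore] -/
theorem fSt_fHN (T' : Regs β) : fSt (rFG q) T' z (q (.f .HN)) = T' (q (.f .HN)) := by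
  simp [fSt, rFG, Function.Embedding.trans_apply, GReg.ιF_apply, gq_ne q]
/-- Writing `HN` commutes with `fSt`. [folklore] -/
theorem fSt_update_fHN (T' : Regs β) : Function.update (fSt (rFG q) T' z) (q (.f .HN)) u = fSt (rFG q) (Function.update T' (q (.f .HN)) u) z := by
  funext y
  by_cases hy : y = (q (.f .HN))
  · subst hy; rw [Function.update_self, fSt_fHN, Function.update_self]
  · rw [Function.update_of_ne hy]; simp only [fSt, Function.update_apply, hy, if_false]
/-- `M2` through `fSt`, driver keys. [folklore] -/
theorem fSt_fM2 (T' : Regs β) : fSt (rFG q) T' z (q (.f .M2)) = T' (q (.f .M2)) := by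
  simp [fSt, rFG, Function.Embedding.trans_apply, GReg.ιF_apply, gq_ne q]
/-- Writing `M2` commutes with `fSt`. [folklore] -/
theorem fSt_update_fM2 (T' : Regs β) : Function.update (fSt (rFG q) T' z) (q (.f .M2)) u = fSt (rFG q) (Function.update T' (q (.f .M2)) u) z := by
  funext y
  by_cases hy : y = (q (.f .M2))
  · subst hy; rw [Function.update_self, fSt_fM2, Function.update_self]
  · rw [Function.update_of_ne hy]; simp only [fSt, Function.update_apply, hy, if_false]
/-- `M4` through `fSt`, driver keys. [folklore] -/
theorem fSt_fM4 (T' : Regs β) : fSt (rFG q) T' z (q (.f .M4)) = T' (q (.f .M4)) := by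
  simp [fSt, rFG, Function.Embedding.trans_apply, GReg.ιF_apply, gq_ne q]
/-- Writing `M4` commutes with `fSt`. [folklore] -/
theorem fSt_update_fM4 (T' : Regs β) : Function.update (fSt (rFG q) T' z) (q (.f .M4)) u = fSt (rFG q) (Function.update T' (q (.f .M4)) u) z := by
  funext y
  by_cases hy : y = (q (.f .M4))
  · subst hy; rw [Function.update_self, fSt_fM4, Function.update_self]
  · rw [Function.update_of_ne hy]; simp only [fSt, Function.update_apply, hy, if_false]
/-- `OUT` through `fSt`, driver keys. [folklore] -/
theorem fSt_fOUT (T' : Regs β) : fSt (rFG q) T' z (q (.f .OUT)) = T' (q (.f .OUT)) := by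
  simp [fSt, rFG, Function.Embedding.trans_apply, GReg.ιF_apply, gq_ne q]
/-- Writing `OUT` commutes with `fSt`. [folklore] -/
theorem fSt_update_fOUT (T' : Regs β) : Function.update (fSt (rFG q) T' z) (q (.f .OUT)) u = fSt (rFG q) (Function.update T' (q (.f .OUT)) u) z := by
  funext y
  by_cases hy : y = (q (.f .OUT))
  · subst hy; rw [Function.update_self, fSt_fOUT, Function.update_self]
  · rw [Function.update_of_ne hy]; simp only [fSt, Function.update_apply, hy, if_false]
/-- `TWOUT` through `fSt`, driver keys. [folklore] -/
theorem fSt_fTWOUT (T' : Regs β) : fSt (rFG q) T' z (q (.f .TWOUT)) = T' (q (.f .TWOUT)) := by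
  simp [fSt, rFG, Function.Embedding.trans_apply, GReg.ιF_apply, gq_ne q]
/-- Writing `TWOUT` commutes with `fSt`. [folklore] -/
theorem fSt_update_fTWOUT (T' : Regs β) : Function.update (fSt (rFG q) T' z) (q (.f .TWOUT)) u = fSt (rFG q) (Function.update T' (q (.f .TWOUT)) u) z := by
  funext y
  by_cases hy : y = (q (.f .TWOUT))
  · subst hy; rw [Function.update_self, fSt_fTWOUT, Function.update_self]
  · rw [Function.update_of_ne hy]; simp only [fSt, Function.update_apply, hy, if_false]
/-- `LEN` through `fSt`, driver keys. [folklore] -/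
theorem fSt_fvLEN (T' : Regs β) : fSt (rFG q) T' z (q (.f (.n (.v .LEN)))) = T' (q (.f (.n (.v .LEN)))) := by
  simp [fSt, rFG, Function.Embedding.trans_apply, GReg.ιF_apply, gq_ne q]
/-- Writing `LEN` commutes with `fSt`. [folklore] -/
theorem fSt_update_fvLEN (T' : Regs β) : Function.update (fSt (rFG q) T' z) (q (.f (.n (.v .LEN)))) u = fSt (rFG q) (Function.update T' (q (.f (.n (.v .LEN)))) u) z := by
  funext y
  by_cases hy : y = (q (.f (.n (.v .LEN))))
  · subst hy; rw [Function.update_self, fSt_fvLEN, Function.update_self]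
  · rw [Function.update_of_ne hy]; simp only [fSt, Function.update_apply, hy, if_false]
/-- `C` through `fSt`, driver keys. [folklore] -/
theorem fSt_fvC (T' : Regs β) : fSt (rFG q) T' z (q (.f (.n (.v .C)))) = T' (q (.f (.n (.v .C)))) := by
  simp [fSt, rFG, Function.Embedding.trans_apply, GReg.ιF_apply, gq_ne q]
/-- Writing `C` commutes with `fSt`. [folklore] -/
theorem fSt_update_fvC (T' : Regs β) : Function.update (fSt (rFG q) T' z) (q (.f (.n (.v .C)))) u = fSt (rFG q) (Function.update T' (q (.f (.n (.v .C)))) u) z := by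
  funext y
  by_cases hy : y = (q (.f (.n (.v .C))))
  · subst hy; rw [Function.update_self, fSt_fvC, Function.update_self]
  · rw [Function.update_of_ne hy]; simp only [fSt, Function.update_apply, hy, if_false]
/-- Reading `BF`. [folklore] -/
@[simp] theorem gSt_BF : gSt q T w (q .BF) = w.bf := by rw [gSt, fSt_gBF, gBase_BF]
/-- Writing `BF`. [folklore] -/
@[simp] theorem update_gSt_BF : Function.update (gSt q T w) (q .BF) u = gSt q T { w with bf := u } := by
  rw [gSt, fSt_update_gBF, update_gBase_BF]; rfl
/-- Reading `BG`. [folklore] -/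
@[simp] theorem gSt_BG : gSt q T w (q .BG) = w.bg := by rw [gSt, fSt_gBG, gBase_BG]
/-- Writing `BG`. [folklore] -/
@[simp] theorem update_gSt_BG : Function.update (gSt q T w) (q .BG) u = gSt q T { w with bg := u } := by
  rw [gSt, fSt_update_gBG, update_gBase_BG]; rfl
/-- Reading `RR`. [folklore] -/
@[simp] theorem gSt_RR : gSt q T w (q .RR) = w.rr := by rw [gSt, fSt_gRR, gBase_RR]
/-- Writing `RR`. [folklore] -/
@[simp] theorem update_gSt_RR : Function.update (gSt q T w) (q .RR) u = gSt q T { w with rr := u } := by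
  rw [gSt, fSt_update_gRR, update_gBase_RR]; rfl
/-- Reading `TW2`. [folklore] -/
@[simp] theorem gSt_TW2 : gSt q T w (q .TW2) = w.tw2 := by rw [gSt, fSt_gTW2, gBase_TW2]
/-- Writing `TW2`. [folklore] -/
@[simp] theorem update_gSt_TW2 : Function.update (gSt q T w) (q .TW2) u = gSt q T { w with tw2 := u } := by
  rw [gSt, fSt_update_gTW2, update_gBase_TW2]; rfl
/-- Reading `TWS`. [folklore] -/
@[simp] theorem gSt_TWS : gSt q T w (q .TWS) = w.tws := by rw [gSt, fSt_gTWS, gBase_TWS]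
/-- Writing `TWS`. [folklore] -/
@[simp] theorem update_gSt_TWS : Function.update (gSt q T w) (q .TWS) u = gSt q T { w with tws := u } := by
  rw [gSt, fSt_update_gTWS, update_gBase_TWS]; rfl
/-- Reading `TW3`. [folklore] -/
@[simp] theorem gSt_TW3 : gSt q T w (q .TW3) = w.tw3 := by rw [gSt, fSt_gTW3, gBase_TW3]
/-- Writing `TW3`. [folklore] -/
@[simp] theorem update_gSt_TW3 : Function.update (gSt q T w) (q .TW3) u = gSt q T { w with tw3 := u } := by
  rw [gSt, fSt_update_gTW3, update_gBase_TW3]; rfl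
/-- Reading `TMPH`. [folklore] -/
@[simp] theorem gSt_TMPH : gSt q T w (q .TMPH) = w.tmph := by rw [gSt, fSt_gTMPH, gBase_TMPH]
/-- Writing `TMPH`. [folklore] -/
@[simp] theorem update_gSt_TMPH : Function.update (gSt q T w) (q .TMPH) u = gSt q T { w with tmph := u } := by
  rw [gSt, fSt_update_gTMPH, update_gBase_TMPH]; rfl
/-- Reading `HIST`. [folklore] -/
@[simp] theorem gSt_HIST : gSt q T w (q .HIST) = w.hist := by rw [gSt, fSt_gHIST, gBase_HIST]
/-- Writing `HIST`. [folklore] -/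
@[simp] theorem update_gSt_HIST : Function.update (gSt q T w) (q .HIST) u = gSt q T { w with hist := u } := by
  rw [gSt, fSt_update_gHIST, update_gBase_HIST]; rfl
/-- Reading `SCHED`. [folklore] -/
@[simp] theorem gSt_SCHED : gSt q T w (q .SCHED) = w.sched := by rw [gSt, fSt_gSCHED, gBase_SCHED]
/-- Writing `SCHED`. [folklore] -/
@[simp] theorem update_gSt_SCHED : Function.update (gSt q T w) (q .SCHED) u = gSt q T { w with sched := u } := by
  rw [gSt, fSt_update_gSCHED, update_gBase_SCHED]; rfl
/-- Reading `KN`. [folklore] -/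
@[simp] theorem gSt_KN : gSt q T w (q .KN) = w.kn := by rw [gSt, fSt_gKN, gBase_KN]
/-- Writing `KN`. [folklore] -/
@[simp] theorem update_gSt_KN : Function.update (gSt q T w) (q .KN) u = gSt q T { w with kn := u } := by
  rw [gSt, fSt_update_gKN, update_gBase_KN]; rfl
/-- Reading `KD`. [folklore] -/
@[simp] theorem gSt_KD : gSt q T w (q .KD) = w.kd := by rw [gSt, fSt_gKD, gBase_KD]
/-- Writing `KD`. [folklore] -/
@[simp] theorem update_gSt_KD : Function.update (gSt q T w) (q .KD) u = gSt q T { w with kd := u } := by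
  rw [gSt, fSt_update_gKD, update_gBase_KD]; rfl
/-- Reading `AR`. [folklore] -/
@[simp] theorem gSt_AR : gSt q T w (q .AR) = w.ar := by rw [gSt, fSt_gAR, gBase_AR]
/-- Writing `AR`. [folklore] -/
@[simp] theorem update_gSt_AR : Function.update (gSt q T w) (q .AR) u = gSt q T { w with ar := u } := by
  rw [gSt, fSt_update_gAR, update_gBase_AR]; rfl
/-- Reading `LVN`. [folklore] -/
@[simp] theorem gSt_LVN : gSt q T w (q .LVN) = w.lvn := by rw [gSt, fSt_gLVN, gBase_LVN]
/-- Writing `LVN`. [folklore] -/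
@[simp] theorem update_gSt_LVN : Function.update (gSt q T w) (q .LVN) u = gSt q T { w with lvn := u } := by
  rw [gSt, fSt_update_gLVN, update_gBase_LVN]; rfl
/-- Reading `LVU`. [folklore] -/
@[simp] theorem gSt_LVU : gSt q T w (q .LVU) = w.lvu := by rw [gSt, fSt_gLVU, gBase_LVU]
/-- Writing `LVU`. [folklore] -/
@[simp] theorem update_gSt_LVU : Function.update (gSt q T w) (q .LVU) u = gSt q T { w with lvu := u } := by
  rw [gSt, fSt_update_gLVU, update_gBase_LVU]; rfl
/-- Reading `MREG`. [folklore] -/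
@[simp] theorem gSt_MREG : gSt q T w (q .MREG) = w.mreg := by rw [gSt, fSt_gMREG, gBase_MREG]
/-- Writing `MREG`. [folklore] -/
@[simp] theorem update_gSt_MREG : Function.update (gSt q T w) (q .MREG) u = gSt q T { w with mreg := u } := by
  rw [gSt, fSt_update_gMREG, update_gBase_MREG]; rfl
/-- Reading `TREG`. [folklore] -/
@[simp] theorem gSt_TREG : gSt q T w (q .TREG) = w.treg := by rw [gSt, fSt_gTREG, gBase_TREG]
/-- Writing `TREG`. [folklore] -/
@[simp] theorem update_gSt_TREG : Function.update (gSt q T w) (q .TREG) u = gSt q T { w with treg := u } := by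
  rw [gSt, fSt_update_gTREG, update_gBase_TREG]; rfl
/-- Reading `W0`. [folklore] -/
@[simp] theorem gSt_W0 : gSt q T w (q .W0) = w.w0 := by rw [gSt, fSt_gW0, gBase_W0]
/-- Writing `W0`. [folklore] -/
@[simp] theorem update_gSt_W0 : Function.update (gSt q T w) (q .W0) u = gSt q T { w with w0 := u } := by
  rw [gSt, fSt_update_gW0, update_gBase_W0]; rfl
/-- Reading the constant `CINV`. [folklore] -/
@[simp] theorem gSt_CINV : gSt q T w (q .CINV) = T (q .CINV) := by rw [gSt, fSt_gCINV, gBase_CINV]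
/-- Reading the constant `THREE`. [folklore] -/
@[simp] theorem gSt_THREE : gSt q T w (q .THREE) = T (q .THREE) := by rw [gSt, fSt_gTHREE, gBase_THREE]
/-- Reading the constant `ONE`. [folklore] -/
@[simp] theorem gSt_ONE : gSt q T w (q .ONE) = T (q .ONE) := by rw [gSt, fSt_gONE, gBase_ONE]
/-- Reading `HN`. [folklore] -/
@[simp] theorem gSt_fHN : gSt q T w (q (.f .HN)) = w.hn := by rw [gSt, fSt_fHN, gBase_HN]
/-- Writing `HN`. [folklore] -/
@[simp] theorem update_gSt_fHN : Function.update (gSt q T w) (q (.f .HN)) u = gSt q T { w with hn := u } := by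
  rw [gSt, fSt_update_fHN, update_gBase_HN]; rfl
/-- Reading `M2`. [folklore] -/
@[simp] theorem gSt_fM2 : gSt q T w (q (.f .M2)) = w.m2 := by rw [gSt, fSt_fM2, gBase_M2]
/-- Writing `M2`. [folklore] -/
@[simp] theorem update_gSt_fM2 : Function.update (gSt q T w) (q (.f .M2)) u = gSt q T { w with m2 := u } := by
  rw [gSt, fSt_update_fM2, update_gBase_M2]; rfl
/-- Reading `M4`. [folklore] -/
@[simp] theorem gSt_fM4 : gSt q T w (q (.f .M4)) = w.m4 := by rw [gSt, fSt_fM4, gBase_M4]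
/-- Writing `M4`. [folklore] -/
@[simp] theorem update_gSt_fM4 : Function.update (gSt q T w) (q (.f .M4)) u = gSt q T { w with m4 := u } := by
  rw [gSt, fSt_update_fM4, update_gBase_M4]; rfl
/-- Reading `OUT`. [folklore] -/
@[simp] theorem gSt_fOUT : gSt q T w (q (.f .OUT)) = w.out := by rw [gSt, fSt_fOUT, gBase_OUT]
/-- Writing `OUT`. [folklore] -/
@[simp] theorem update_gSt_fOUT : Function.update (gSt q T w) (q (.f .OUT)) u = gSt q T { w with out := u } := by
  rw [gSt, fSt_update_fOUT, update_gBase_OUT]; rfl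
/-- Reading `TWOUT`. [folklore] -/
@[simp] theorem gSt_fTWOUT : gSt q T w (q (.f .TWOUT)) = w.twout := by rw [gSt, fSt_fTWOUT, gBase_TWOUT]
/-- Writing `TWOUT`. [folklore] -/
@[simp] theorem update_gSt_fTWOUT : Function.update (gSt q T w) (q (.f .TWOUT)) u = gSt q T { w with twout := u } := by
  rw [gSt, fSt_update_fTWOUT, update_gBase_TWOUT]; rfl
/-- Reading `LEN`. [folklore] -/
@[simp] theorem gSt_fvLEN : gSt q T w (q (.f (.n (.v .LEN)))) = w.len := by rw [gSt, fSt_fvLEN, gBase_LEN]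
/-- Writing `LEN`. [folklore] -/
@[simp] theorem update_gSt_fvLEN : Function.update (gSt q T w) (q (.f (.n (.v .LEN)))) u = gSt q T { w with len := u } := by
  rw [gSt, fSt_update_fvLEN, update_gBase_LEN]; rfl
/-- Reading `C`. [folklore] -/
@[simp] theorem gSt_fvC : gSt q T w (q (.f (.n (.v .C)))) = w.cc := by rw [gSt, fSt_fvC, gBase_C]
/-- Writing `C`. [folklore] -/
@[simp] theorem update_gSt_fvC : Function.update (gSt q T w) (q (.f (.n (.v .C)))) u = gSt q T { w with cc := u } := by
  rw [gSt, fSt_update_fvC, update_gBase_C]; rfl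
/-- Reading the slot `IN`. [folklore] -/
@[simp] theorem gSt_sIN : gSt q T w (q (.f .IN)) = w.fz.inp := by
  have h := fSt_IN (rFG q) (gBase q T w) w.fz
  simp only [rFG, Function.Embedding.trans_apply, GReg.ιF_apply] at h
  rw [gSt, h]
/-- Writing the slot `IN`. [folklore] -/
@[simp] theorem update_gSt_sIN : Function.update (gSt q T w) (q (.f .IN)) u = gSt q T { w with fz := { w.fz with inp := u } } := by
  have h := update_fSt_IN (rFG q) (gBase q T w) w.fz u
  simp only [rFG, Function.Embedding.trans_apply, GReg.ιF_apply] at h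
  rw [gSt, h]; rfl
/-- Reading the slot `HOLD`. [folklore] -/
@[simp] theorem gSt_sHOLD : gSt q T w (q (.f .HOLD)) = w.fz.hold := by
  have h := fSt_HOLD (rFG q) (gBase q T w) w.fz
  simp only [rFG, Function.Embedding.trans_apply, GReg.ιF_apply] at h
  rw [gSt, h]
/-- Writing the slot `HOLD`. [folklore] -/
@[simp] theorem update_gSt_sHOLD : Function.update (gSt q T w) (q (.f .HOLD)) u = gSt q T { w with fz := { w.fz with hold := u } } := by
  have h := update_fSt_HOLD (rFG q) (gBase q T w) w.fz u
  simp only [rFG, Function.Embedding.trans_apply, GReg.ιF_apply] at h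
  rw [gSt, h]; rfl
/-- Reading the slot `HOLD2`. [folklore] -/
@[simp] theorem gSt_sHOLD2 : gSt q T w (q (.f .HOLD2)) = w.fz.hold2 := by
  have h := fSt_HOLD2 (rFG q) (gBase q T w) w.fz
  simp only [rFG, Function.Embedding.trans_apply, GReg.ιF_apply] at h
  rw [gSt, h]
/-- Writing the slot `HOLD2`. [folklore] -/
@[simp] theorem update_gSt_sHOLD2 : Function.update (gSt q T w) (q (.f .HOLD2)) u = gSt q T { w with fz := { w.fz with hold2 := u } } := by
  have h := update_fSt_HOLD2 (rFG q) (gBase q T w) w.fz u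
  simp only [rFG, Function.Embedding.trans_apply, GReg.ιF_apply] at h
  rw [gSt, h]; rfl
/-- Reading the slot `TMP`. [folklore] -/
@[simp] theorem gSt_sTMP : gSt q T w (q (.f .TMP)) = w.fz.tmp := by
  have h := fSt_TMP (rFG q) (gBase q T w) w.fz
  simp only [rFG, Function.Embedding.trans_apply, GReg.ιF_apply] at h
  rw [gSt, h]
/-- Writing the slot `TMP`. [folklore] -/
@[simp] theorem update_gSt_sTMP : Function.update (gSt q T w) (q (.f .TMP)) u = gSt q T { w with fz := { w.fz with tmp := u } } := by
  have h := update_fSt_TMP (rFG q) (gBase q T w) w.fz u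
  simp only [rFG, Function.Embedding.trans_apply, GReg.ιF_apply] at h
  rw [gSt, h]; rfl
/-- Reading the slot `TW`. [folklore] -/
@[simp] theorem gSt_sTW : gSt q T w (q (.f .TW)) = w.fz.tw := by
  have h := fSt_TW (rFG q) (gBase q T w) w.fz
  simp only [rFG, Function.Embedding.trans_apply, GReg.ιF_apply] at h
  rw [gSt, h]
/-- Writing the slot `TW`. [folklore] -/
@[simp] theorem update_gSt_sTW : Function.update (gSt q T w) (q (.f .TW)) u = gSt q T { w with fz := { w.fz with tw := u } } := by
  have h := update_fSt_TW (rFG q) (gBase q T w) w.fz u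
  simp only [rFG, Function.Embedding.trans_apply, GReg.ιF_apply] at h
  rw [gSt, h]; rfl
/-- Reading the slot `TWACC`. [folklore] -/
@[simp] theorem gSt_sTWACC : gSt q T w (q (.f .TWACC)) = w.fz.twacc := by
  have h := fSt_TWACC (rFG q) (gBase q T w) w.fz
  simp only [rFG, Function.Embedding.trans_apply, GReg.ιF_apply] at h
  rw [gSt, h]
/-- Writing the slot `TWACC`. [folklore] -/
@[simp] theorem update_gSt_sTWACC : Function.update (gSt q T w) (q (.f .TWACC)) u = gSt q T { w with fz := { w.fz with twacc := u } } := by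
  have h := update_fSt_TWACC (rFG q) (gBase q T w) w.fz u
  simp only [rFG, Function.Embedding.trans_apply, GReg.ιF_apply] at h
  rw [gSt, h]; rfl
/-- Reading the slot `T1`. [folklore] -/
@[simp] theorem gSt_sT1 : gSt q T w (q (.f .T1)) = w.fz.t1 := by
  have h := fSt_T1 (rFG q) (gBase q T w) w.fz
  simp only [rFG, Function.Embedding.trans_apply, GReg.ιF_apply] at h
  rw [gSt, h]
/-- Writing the slot `T1`. [folklore] -/
@[simp] theorem update_gSt_sT1 : Function.update (gSt q T w) (q (.f .T1)) u = gSt q T { w with fz := { w.fz with t1 := u } } := by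
  have h := update_fSt_T1 (rFG q) (gBase q T w) w.fz u
  simp only [rFG, Function.Embedding.trans_apply, GReg.ιF_apply] at h
  rw [gSt, h]; rfl
/-- Reading the slot `CNT`. [folklore] -/
@[simp] theorem gSt_sCNT : gSt q T w (q (.f .CNT)) = w.fz.cnt := by
  have h := fSt_CNT (rFG q) (gBase q T w) w.fz
  simp only [rFG, Function.Embedding.trans_apply, GReg.ιF_apply] at h
  rw [gSt, h]
/-- Writing the slot `CNT`. [folklore] -/
@[simp] theorem update_gSt_sCNT : Function.update (gSt q T w) (q (.f .CNT)) u = gSt q T { w with fz := { w.fz with cnt := u } } := by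
  have h := update_fSt_CNT (rFG q) (gBase q T w) w.fz u
  simp only [rFG, Function.Embedding.trans_apply, GReg.ιF_apply] at h
  rw [gSt, h]; rfl
/-- Reading the slot `X1`. [folklore] -/
@[simp] theorem gSt_sX1 : gSt q T w (q (.f .X1)) = w.fz.x1 := by
  have h := fSt_X1 (rFG q) (gBase q T w) w.fz
  simp only [rFG, Function.Embedding.trans_apply, GReg.ιF_apply] at h
  rw [gSt, h]
/-- Writing the slot `X1`. [folklore] -/
@[simp] theorem update_gSt_sX1 : Function.update (gSt q T w) (q (.f .X1)) u = gSt q T { w with fz := { w.fz with x1 := u } } := by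
  have h := update_fSt_X1 (rFG q) (gBase q T w) w.fz u
  simp only [rFG, Function.Embedding.trans_apply, GReg.ιF_apply] at h
  rw [gSt, h]; rfl
/-- Reading the slot `X2`. [folklore] -/
@[simp] theorem gSt_sX2 : gSt q T w (q (.f .X2)) = w.fz.x2 := by
  have h := fSt_X2 (rFG q) (gBase q T w) w.fz
  simp only [rFG, Function.Embedding.trans_apply, GReg.ιF_apply] at h
  rw [gSt, h]
/-- Writing the slot `X2`. [folklore] -/
@[simp] theorem update_gSt_sX2 : Function.update (gSt q T w) (q (.f .X2)) u = gSt q T { w with fz := { w.fz with x2 := u } } := by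
  have h := update_fSt_X2 (rFG q) (gBase q T w) w.fz u
  simp only [rFG, Function.Embedding.trans_apply, GReg.ιF_apply] at h
  rw [gSt, h]; rfl
/-- Reading the slot `OACC`. [folklore] -/
@[simp] theorem gSt_sOACC : gSt q T w (q (.f .OACC)) = w.fz.oacc := by
  have h := fSt_OACC (rFG q) (gBase q T w) w.fz
  simp only [rFG, Function.Embedding.trans_apply, GReg.ιF_apply] at h
  rw [gSt, h]
/-- Writing the slot `OACC`. [folklore] -/
@[simp] theorem update_gSt_sOACC : Function.update (gSt q T w) (q (.f .OACC)) u = gSt q T { w with fz := { w.fz with oacc := u } } := by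
  have h := update_fSt_OACC (rFG q) (gBase q T w) w.fz u
  simp only [rFG, Function.Embedding.trans_apply, GReg.ιF_apply] at h
  rw [gSt, h]; rfl
/-- Reading the slot `SACC`. [folklore] -/
@[simp] theorem gSt_sSACC : gSt q T w (q (.f .SACC)) = w.fz.sacc := by
  have h := fSt_SACC (rFG q) (gBase q T w) w.fz
  simp only [rFG, Function.Embedding.trans_apply, GReg.ιF_apply] at h
  rw [gSt, h]
/-- Writing the slot `SACC`. [folklore] -/
@[simp] theorem update_gSt_sSACC : Function.update (gSt q T w) (q (.f .SACC)) u = gSt q T { w with fz := { w.fz with sacc := u } } := by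
  have h := update_fSt_SACC (rFG q) (gBase q T w) w.fz u
  simp only [rFG, Function.Embedding.trans_apply, GReg.ιF_apply] at h
  rw [gSt, h]; rfl
/-- Reading the slot `E`. [folklore] -/
@[simp] theorem gSt_sE : gSt q T w (q (.f (.n (.v .E)))) = w.fz.e := by
  have h := fSt_E (rFG q) (gBase q T w) w.fz
  simp only [rFG, Function.Embedding.trans_apply, GReg.ιF_apply] at h
  rw [gSt, h]
/-- Writing the slot `E`. [folklore] -/
@[simp] theorem update_gSt_sE : Function.update (gSt q T w) (q (.f (.n (.v .E)))) u = gSt q T { w with fz := { w.fz with e := u } } := by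
  have h := update_fSt_E (rFG q) (gBase q T w) w.fz u
  simp only [rFG, Function.Embedding.trans_apply, GReg.ιF_apply] at h
  rw [gSt, h]; rfl
/-- Reading the slot `L1`. [folklore] -/
@[simp] theorem gSt_sL1 : gSt q T w (q (.f (.n (.v .L1)))) = w.fz.l1 := by
  have h := fSt_L1 (rFG q) (gBase q T w) w.fz
  simp only [rFG, Function.Embedding.trans_apply, GReg.ιF_apply] at h
  rw [gSt, h]
/-- Writing the slot `L1`. [folklore] -/
@[simp] theorem update_gSt_sL1 : Function.update (gSt q T w) (q (.f (.n (.v .L1)))) u = gSt q T { w with fz := { w.fz with l1 := u } } := by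
  have h := update_fSt_L1 (rFG q) (gBase q T w) w.fz u
  simp only [rFG, Function.Embedding.trans_apply, GReg.ιF_apply] at h
  rw [gSt, h]; rfl
/-- Reading the slot `L2`. [folklore] -/
@[simp] theorem gSt_sL2 : gSt q T w (q (.f (.n (.v .L2)))) = w.fz.l2 := by
  have h := fSt_L2 (rFG q) (gBase q T w) w.fz
  simp only [rFG, Function.Embedding.trans_apply, GReg.ιF_apply] at h
  rw [gSt, h]
/-- Writing the slot `L2`. [folklore] -/
@[simp] theorem update_gSt_sL2 : Function.update (gSt q T w) (q (.f (.n (.v .L2)))) u = gSt q T { w with fz := { w.fz with l2 := u } } := by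
  have h := update_fSt_L2 (rFG q) (gBase q T w) w.fz u
  simp only [rFG, Function.Embedding.trans_apply, GReg.ιF_apply] at h
  rw [gSt, h]; rfl
/-- Reading the slot `DST`. [folklore] -/
@[simp] theorem gSt_sDST : gSt q T w (q (.f (.n (.v .DST)))) = w.fz.dst := by
  have h := fSt_DST (rFG q) (gBase q T w) w.fz
  simp only [rFG, Function.Embedding.trans_apply, GReg.ιF_apply] at h
  rw [gSt, h]
/-- Writing the slot `DST`. [folklore] -/
@[simp] theorem update_gSt_sDST : Function.update (gSt q T w) (q (.f (.n (.v .DST)))) u = gSt q T { w with fz := { w.fz with dst := u } } := by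
  have h := update_fSt_DST (rFG q) (gBase q T w) w.fz u
  simp only [rFG, Function.Embedding.trans_apply, GReg.ιF_apply] at h
  rw [gSt, h]; rfl
/-- Reading an untouched vector-pass register. [folklore] -/
theorem gSt_v {x : VReg} (h1 : x ≠ .LEN) (h2 : x ≠ .C) (h3 : x ≠ .E) (h4 : x ≠ .L1) (h5 : x ≠ .L2) (h6 : x ≠ .DST) :
    gSt q T w (q (.f (.n (.v x)))) = T (q (.f (.n (.v x)))) := by
  have h := fSt_v (rFG q) (gBase q T w) w.fz h3 h4 h5 h6
  simp only [rFG, Function.Embedding.trans_apply, GReg.ιF_apply] at h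
  rw [gSt, h, gBase_v q T w h1 h2]
/-- Reading an untouched multiplier register (`FP GP ACC`). [folklore] -/
theorem gSt_n {x : NReg} (h1 : x ≠ .v .LEN) (h2 : x ≠ .v .C) (h3 : x ≠ .v .E) (h4 : x ≠ .v .L1) (h5 : x ≠ .v .L2) (h6 : x ≠ .v .DST) :
    gSt q T w (q (.f (.n x))) = T (q (.f (.n x))) := by
  have h := fSt_n (rFG q) (gBase q T w) w.fz h3 h4 h5 h6
  simp only [rFG, Function.Embedding.trans_apply, GReg.ιF_apply] at h
  rw [gSt, h, gBase_n q T w h1 h2]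

end GStLemmas2

section GStLemmas3

variable (T : Regs β) (w : GSlots) (u : List Bool)

/-- Writing an untouched vector-pass register of the base commutes. [folklore] -/
theorem update_gBase_v {x : VReg} (h1 : x ≠ .LEN) (h2 : x ≠ .C) :
    Function.update (gBase q T w) (q (.f (.n (.v x)))) u = gBase q (Function.update T (q (.f (.n (.v x)))) u) w := by
  funext y
  by_cases hy : y = q (.f (.n (.v x)))
  · subst hy; rw [Function.update_self, gBase_v q _ w h1 h2, Function.update_self]
  · rw [Function.update_of_ne hy]; simp only [gBase, Function.update_apply, hy, if_false]

/-- Writing an untouched vector-pass register (`U`, `D`, `W`, …) moves into the ambient file. [folklore] -/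
theorem update_gSt_v {x : VReg} (h1 : x ≠ .LEN) (h2 : x ≠ .C) (h3 : x ≠ .E) (h4 : x ≠ .L1) (h5 : x ≠ .L2) (h6 : x ≠ .DST) :
    Function.update (gSt q T w) (q (.f (.n (.v x)))) u = gSt q (Function.update T (q (.f (.n (.v x)))) u) w := by
  have h := fSt_update_v (rFG q) (gBase q T w) w.fz h3 h4 h5 h6 u
  simp only [rFG, Function.Embedding.trans_apply, GReg.ιF_apply] at h
  rw [gSt, ← h, gSt, update_gBase_v q T w u h1 h2]

/-- Writing an untouched multiplier register of the base commutes. [folklore] -/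
theorem update_gBase_n {x : NReg} (h1 : x ≠ .v .LEN) (h2 : x ≠ .v .C) :
    Function.update (gBase q T w) (q (.f (.n x))) u = gBase q (Function.update T (q (.f (.n x))) u) w := by
  funext y
  by_cases hy : y = q (.f (.n x))
  · subst hy; rw [Function.update_self, gBase_n q _ w h1 h2, Function.update_self]
  · rw [Function.update_of_ne hy]; simp only [gBase, Function.update_apply, hy, if_false]

/-- Writing an untouched multiplier register (`FP GP ACC`) moves into the ambient file. [folklore] -/
theorem update_gSt_n {x : NReg} (h1 : x ≠ .v .LEN) (h2 : x ≠ .v .C) (h3 : x ≠ .v .E) (h4 : x ≠ .v .L1) (h5 : x ≠ .v .L2) (h6 : x ≠ .v .DST) :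
    Function.update (gSt q T w) (q (.f (.n x))) u = gSt q (Function.update T (q (.f (.n x))) u) w := by
  have h := fSt_update_n (rFG q) (gBase q T w) w.fz h3 h4 h5 h6 u
  simp only [rFG, Function.Embedding.trans_apply, GReg.ιF_apply] at h
  rw [gSt, ← h, gSt, update_gBase_n q T w u h1 h2]

/-- A driver state is a level-pass state over the driver's base file. [folklore] -/
theorem gSt_eq_fSt : gSt q T w = fSt (rFG q) (gBase q T w) w.fz := rfl

/-- The base file does not depend on the level-pass record. [folklore] -/
@[simp] theorem gBase_with_fz (z : FSlots) : gBase q T { w with fz := z } = gBase q T w := rfl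

/-- Back from a level-pass state over the driver's base file to a driver state. [folklore] -/
theorem fSt_gBase (z : FSlots) : fSt (rFG q) (gBase q T w) z = gSt q T { w with fz := z } := rfl

end GStLemmas3


end Com

end Literature.Computability.Complexity
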